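import Mathlib.RingTheory.MvPolynomial.Symmetric.Defs
import Mathlib.RingTheory.Localization.Away.Basic
import Mathlib.RingTheory.Polynomial.Vieta
import Mathlib.LinearAlgebra.Matrix.GeneralLinearGroup.Defs
import Mathlib.NumberTheory.LocalField.Basic
import Mathlib.Algebra.Group.Pi.Units
import Mathlib.Analysis.Real.Sqrt
import Mathlib.MeasureTheory.Measure.Haar.Basic
import Literature.NumberTheory.Automorphic.HeckeAlgebra
import Literature.NumberTheory.Automorphic.SmoothRepresentation
import Literature.NumberTheory.Automorphic.ReductiveGroupData
import Literature.NumberTheory.Automorphic.LParameter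
import Literature.NumberTheory.Automorphic.MatrixCoefficients
import Literature.NumberTheory.GaloisRepresentations.LocalField
import HarnessLib

-- D-0014 sorry-sweep (operator, 2026-08-13): sorried theorems -> named facts `def X : Prop`; partial proofs preserved in comments
-- provenance: harness21/H21/H21/Prelude/AutomorphicAxiomatic/SatakeParametersGL.lean @ f40db45 (interim HEAD d8f2665); M5 mechanical rewrite
/-!
# Satake parameters for `GL_n` over a non-archimedean local field (trunk: AutomorphicAxiomatic)

Item C7 of the outline (`SatakeParametersGL`, notion `satake_isomorphism`).  Let `F` be a
non-archimedean local field with residue field of cardinality `q`, `ϖ` a uniformizer,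
`G = GL_n(F)` and `K₀ = GL_n(𝒪_F) = glInt n F`.  The spherical Hecke algebra `ℋ(G, K₀)` is
generated by the operators `T_i = [K₀ diag(ϖ,…,ϖ,1,…,1) K₀]` (`i` entries `ϖ`, `0 ≤ i ≤ n`,
`T_n` invertible) and the **Satake isomorphism** identifies it with the symmetric Laurent
polynomials `ℂ[x_1^{±1}, …, x_n^{±1}]^{S_n} = ℂ[e_1, …, e_n, e_n⁻¹]`
(Satake 1963; Tamagawa 1963; Cartier, Corvallis 1979, §IV; Shimura, *Introduction to the
arithmetic theory of automorphic functions*, Theorem 3.21; Gross, *On the Satake isomorphism*,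
§3).  An irreducible admissible unramified representation `ρ` has a line of `K₀`-fixed vectors on
which `T_i` acts by the scalar `q^{i(n-i)/2} e_i(α_1, …, α_n)` for a unique multiset
`α = {α_1, …, α_n}` of non-zero complex numbers, its **Satake parameters** (Tamagawa/Shimura
unitary normalisation, in which tempered ⇔ `|α_j| = 1`).

## Contents

* `heckeDiag n ϖ i = diag(ϖ,…,ϖ,1,…,1) ∈ GL_n(F)`; `heckeT ρ ϖ i`, the Hecke operator `T_i` on a
  representation `ρ` (via `heckeOperator` of module `HeckeAlgebra`).
* `IsSatakeParameter ρ ϖ α`: `α` (a multiset of card `n`) is a Satake parameter of `ρ`.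
* `satakePolynomial α = ∏ (X - α_j)`, `heckePolynomial q n t = ∑ (-1)^i q^{i(i-1)/2} t_i X^{n-i}`
  and the algebraic identity `heckePolynomial_eq_satakePolynomial` (Tamagawa 1963; Shimura
  Theorem 3.21) relating them under `t_i = q^{i(n-i)/2} e_i(α)`.
* `symmLaurent n = ℂ[e_1,…,e_n][e_n⁻¹]`, the target of Satake for `GL_n`, as the localisation of
  Mathlib's `MvPolynomial.symmetricSubalgebra (Fin n) ℂ` away from `esymm n`, and its comparison
  `symmLaurent_equiv_weylInvariants` with `weylInvariants ℂ ℤⁿ S_n` of module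
  `ReductiveGroupData`.
* Theorems (proofs deferred): `satake_gl`, `isGelfandPair_glInt`,
  `finrank_fixedPoints_glInt_le_one`, `existsUnique_isSatakeParameter`,
  `isSatakeParameter_indep`, `IsSatakeParameter.forall_ne_zero`,
  `isTempered_iff_forall_norm_eq_one`.
* `LParameter.IsUnramifiedWith φ α`: the unramified L-parameter of `GL_n` with Frobenius
  eigenvalues `α` (link to module `LParameter`).

## Mathlib searches

`Satake`, `heckePolynomial`, spherical Hecke algebra: nothing in Mathlib.  Used from Mathlib:
`Matrix.GeneralLinearGroup`, `Matrix.diagonalRingHom`, `MulEquiv.piUnits`, `Multiset.esymm`,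
`MvPolynomial.esymm`, `MvPolynomial.symmetricSubalgebra`, `MvPolynomial.esymm_isSymmetric`,
`Localization.Away`, `Polynomial`, `Valuation.IsUniformizer`, `Real.sqrt`.

## Design notes

* All declarations are in `namespace Literature.Automorphic` (review F2), except
  `Literature.NumberTheory.Automorphic.LParameter.IsUnramifiedWith` (dot-notation on the H21 structure `LParameter`).
* Normalisation (review F9): `T_i ↔ q^{i(n-i)/2} e_i(α)`; then
  `∑ (-1)^i q^{i(i-1)/2} T_i X^{n-i} = ∏_j (X - q^{(n-1)/2} α_j)` since
  `i(i-1)/2 + i(n-i)/2 = i(n-1)/2`.  `q^{1/2}` is `Real.sqrt q` coerced to `ℂ`.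
* `ℕ`-subtraction: in `IsSatakeParameter` and `heckePolynomial_eq_satakePolynomial` the exponent
  `i * (n - i)` only occurs under `i ≤ n`; in `heckePolynomial` the exponent `i * (i - 1) / 2` is
  the exact integer `binom(i, 2)` for all `i : ℕ` (at `i = 0` it is `0`), and `X ^ (n - i)` only
  occurs for `i ∈ range (n + 1)`.
* `IsSatakeParameter` asks for *some* non-zero common eigenvector in `V^{K₀}`; this is the right
  notion when `dim V^{K₀} = 1` (`finrank_fixedPoints_glInt_le_one`), e.g. for `ρ` irreducible
  admissible, and is documented as such.

## References

* I. Satake, *Theory of spherical functions on reductive algebraic groups over p-adic fields*,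
  Publ. IHÉS 18 (1963).
* T. Tamagawa, *On the ζ-functions of a division algebra*, Ann. of Math. 77 (1963).
* P. Cartier, *Representations of p-adic groups: a survey*, Corvallis 1979, part 1, §IV.
* G. Shimura, *Introduction to the arithmetic theory of automorphic functions*, Theorem 3.21.
* B. Gross, *On the Satake isomorphism*, in *Galois representations in arithmetic algebraic
  geometry* (1998), §3.
* A. Borel, *Automorphic L-functions*, Corvallis 1979, part 2, §§7, 9, 10.
-/

universe u

open Matrix ValuativeRel Polynomial
open scoped MatrixGroups

namespace Literature.NumberTheory.Automorphic

/-! ### Hecke operators `T_i` -/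

section Hecke

variable (n : ℕ) {F : Type u} [Field F]

/-- The diagonal matrix `diag(ϖ, …, ϖ, 1, …, 1) ∈ GL_n(F)` with `ϖ` in the first `i` diagonal
entries (all entries `ϖ` if `n ≤ i`): a representative of the double coset defining the Hecke
operator `T_i` (Shimura, Theorem 3.21; Cartier, Corvallis 1979, §IV.1).
[cite: CartierCorvallis1979, §IV.1] -/
def heckeDiag (ϖ : Fˣ) (i : ℕ) : GL (Fin n) F :=
  Units.map (Matrix.diagonalRingHom (Fin n) F).toMonoidHom
    (MulEquiv.piUnits.symm fun j : Fin n => if (j : ℕ) < i then ϖ else 1)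

/-- The underlying matrix of `heckeDiag n ϖ i` is the diagonal matrix with entries `ϖ` at indices
`< i` and `1` otherwise. [folklore] -/
@[simp]
theorem coe_heckeDiag (ϖ : Fˣ) (i : ℕ) :
    ((heckeDiag n ϖ i : GL (Fin n) F) : Matrix (Fin n) (Fin n) F) =
      Matrix.diagonal fun j : Fin n => if (j : ℕ) < i then (ϖ : F) else 1 := by
  rw [heckeDiag, Units.coe_map]
  change Matrix.diagonal (fun j : Fin n => ((if (j : ℕ) < i then ϖ else 1 : Fˣ) : F)) = _
  congr 1
  ext j
  split_ifs <;> rfl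

variable {n} [ValuativeRel F]
variable {V : Type*} [AddCommGroup V] [Module ℂ V] (ρ : Representation ℂ (GL (Fin n) F) V)

/-- The **Hecke operator `T_i`** (`0 ≤ i ≤ n`) of `GL_n(F)` relative to `K₀ = GL_n(𝒪_F)` acting on
a representation `ρ`: the operator of the double coset `K₀ diag(ϖ,…,ϖ,1,…,1) K₀` (`i` entries
`ϖ`), i.e. `heckeOperator ρ (glInt n F) (heckeDiag n ϖ i)`.  Meaningful on `V^{K₀}` and for `ϖ` a
uniformizer (Shimura, Theorem 3.21; Cartier, Corvallis 1979, §IV.1).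
[cite: CartierCorvallis1979, §IV.1] -/
noncomputable def heckeT (ϖ : Fˣ) (i : ℕ) : Module.End ℂ V :=
  heckeOperator ρ (glInt n F) (heckeDiag n ϖ i)

/-- Unfolding lemma for `heckeT`. [folklore] -/
theorem heckeT_def (ϖ : Fˣ) (i : ℕ) :
    heckeT ρ ϖ i = heckeOperator ρ (glInt n F) (heckeDiag n ϖ i) :=
  rfl

end Hecke

/-! ### Satake parameters -/

section Satake

variable {n : ℕ} {F : Type u} [Field F] [ValuativeRel F] [TopologicalSpace F]
  [IsNonarchimedeanLocalField F]
variable {V : Type*} [AddCommGroup V] [Module ℂ V] (ρ : Representation ℂ (GL (Fin n) F) V)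

open GaloisRepresentations.IsNonarchimedeanLocalField in
/-- `α = {α_1, …, α_n}` is a multiset of **Satake parameters** of the representation `ρ` of
`GL_n(F)` (with respect to the uniformizer `ϖ`): `α` has `n` elements and there is a non-zero
`K₀`-fixed vector `v` on which every Hecke operator `T_i`, `i ≤ n`, acts by the scalar
`q^{i(n-i)/2} e_i(α)` (`q` the residue cardinality, `e_i` the elementary symmetric function;
Tamagawa/Shimura unitary normalisation).  Meaningful when `dim V^{K₀} = 1`, e.g. for `ρ`
irreducible admissible unramified (`finrank_fixedPoints_glInt_le_one`), in which case `α` exists,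
is unique and independent of `ϖ` (Shimura, Theorem 3.21; Cartier, Corvallis 1979, §IV.4;
Borel, Corvallis 1979, §7). [cite: CartierCorvallis1979, §IV.4] -/
def IsSatakeParameter (ϖ : Fˣ) (α : Multiset ℂ) : Prop :=
  Multiset.card α = n ∧ ∃ v ∈ ρ.fixedPoints (glInt n F), v ≠ 0 ∧
    ∀ i ≤ n, heckeT ρ ϖ i v =
      (((Real.sqrt (residueFieldCard F) ^ (i * (n - i)) : ℝ) : ℂ) * α.esymm i) • v

end Satake

/-! ### Satake and Hecke polynomials -/

section Polynomials

/-- The **Satake polynomial** `∏_{a ∈ α} (X - a)` of a multiset `α` of complex numbers: for `α`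
the Satake parameters of `ρ` this is the characteristic polynomial of the Satake (Langlands)
class of `ρ`, whose reciprocal gives the local Euler factor `L(s, ρ)⁻¹ = ∏ (1 - α_j q^{-s})`
(Borel, Corvallis 1979, §7; Shimura, Theorem 3.21).  Compare Mathlib's Vieta formula
`Multiset.prod_X_sub_C_coeff`. [cite: BorelCorvallis1979, §7] -/
noncomputable def satakePolynomial (α : Multiset ℂ) : ℂ[X] :=
  (α.map fun a => X - C a).prod

/-- The Satake polynomial has degree `card α`. [folklore] -/
theorem natDegree_satakePolynomial (α : Multiset ℂ) :
    (satakePolynomial α).natDegree = Multiset.card α := by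
  rw [satakePolynomial, natDegree_multiset_prod_X_sub_C_eq_card]

/-- The roots of the Satake polynomial are `α`. [folklore] -/
theorem roots_satakePolynomial (α : Multiset ℂ) : (satakePolynomial α).roots = α := by
  rw [satakePolynomial, Polynomial.roots_multiset_prod_X_sub_C]

/-- The **Hecke polynomial** of `GL_n` attached to eigenvalues `t_0 = 1, t_1, …, t_n` of the Hecke
operators `T_i` (only `t_0, …, t_n` are used):
`∑_{i=0}^{n} (-1)^i q^{i(i-1)/2} t_i X^{n-i}` (Tamagawa 1963; Shimura, Theorem 3.21).  The
exponent `i * (i - 1) / 2` is the exact natural number `binom(i, 2)`.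
[cite: ShimuraIATAF1971, Theorem 3.21] -/
noncomputable def heckePolynomial (q n : ℕ) (t : ℕ → ℂ) : ℂ[X] :=
  ∑ i ∈ Finset.range (n + 1), C ((-1) ^ i * (q : ℂ) ^ (i * (i - 1) / 2) * t i) * X ^ (n - i)

/-- **Tamagawa's identity** (Tamagawa 1963, Shimura, *Introduction to the arithmetic theory of
automorphic functions*, Theorem 3.21): if `t_i = q^{i(n-i)/2} e_i(α)` for `i ≤ n` (the Satake
normalisation of `IsSatakeParameter`) and `card α = n`, then
`∑ (-1)^i q^{i(i-1)/2} t_i X^{n-i} = ∏_j (X - q^{(n-1)/2} α_j)`, because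
`i(i-1)/2 + i(n-i)/2 = i(n-1)/2` and `e_i(c • α) = c^i e_i(α)`.  Pure algebra (Tamagawa (1963),
`TamagawaAnnals1963`). [cite: ShimuraIATAF1971, Theorem 3.21] -/
def heckePolynomial_eq_satakePolynomial : Prop :=
  ∀ (q n : ℕ) (t : ℕ → ℂ) (α : Multiset ℂ)
    (_h : ∀ i ≤ n, t i = ((Real.sqrt q : ℝ) : ℂ) ^ (i * (n - i)) * α.esymm i)
    (_hα : Multiset.card α = n),
    heckePolynomial q n t =
      satakePolynomial (α.map fun a => ((Real.sqrt q : ℝ) : ℂ) ^ (n - 1) * a)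

end Polynomials

/-! ### The target of the Satake isomorphism for `GL_n` -/

section SymmLaurent

variable (n : ℕ)

/-- The `n`-th elementary symmetric polynomial `e_n = x_1 ⋯ x_n` as an element of Mathlib's
subalgebra of symmetric polynomials `MvPolynomial.symmetricSubalgebra (Fin n) ℂ`
(`MvPolynomial.esymm_isSymmetric`). [folklore] -/
noncomputable def esymmTop : MvPolynomial.symmetricSubalgebra (Fin n) ℂ :=
  ⟨MvPolynomial.esymm (Fin n) ℂ n, MvPolynomial.esymm_isSymmetric _ _ n⟩

/-- Unfolding lemma for `esymmTop`. [folklore] -/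
@[simp]
theorem coe_esymmTop :
    (esymmTop n : MvPolynomial (Fin n) ℂ) = MvPolynomial.esymm (Fin n) ℂ n :=
  rfl

/-- The algebra of **symmetric Laurent polynomials**
`ℂ[x_1^{±1}, …, x_n^{±1}]^{S_n} = ℂ[e_1, …, e_n][e_n⁻¹]`, realised as the localisation
(`Localization.Away`) of the symmetric polynomials `ℂ[x_1, …, x_n]^{S_n}`
(`MvPolynomial.symmetricSubalgebra`) away from `e_n = x_1 ⋯ x_n`: the target of the Satake
isomorphism for `GL_n`, i.e. `ℂ[X_*(T)]^W = ℂ[ℤⁿ]^{S_n}` (Cartier, Corvallis 1979, §IV.2,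
Example; Gross, *On the Satake isomorphism*, §3). [cite: CartierCorvallis1979, §IV.2 Example] -/
abbrev symmLaurent : Type :=
  Localization.Away (esymmTop n)

/-- `ℂ[e_1, …, e_n][e_n⁻¹] ≅ ℂ[ℤⁿ]^{S_n}`: the localised symmetric polynomials are the
`S_n`-invariants of the group algebra of the cocharacter lattice `ℤⁿ` of the diagonal torus of
`GL_n` (`weylInvariants` of module `ReductiveGroupData`, with `glWeylGroup n = S_n`, the Weyl
group of the datum `ConnectedReductiveGroupData.gl n F`).  Both sides are
`ℂ[x_1^{±1}, …, x_n^{±1}]^{S_n}` (Cartier, Corvallis 1979, §IV.2; Gross, §3).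
[cite: CartierCorvallis1979, §IV.2] -/
def symmLaurent_equiv_weylInvariants : Prop :=
  Nonempty (symmLaurent n ≃ₐ[ℂ]
      weylInvariants ℂ (Fin n → ℤ) (ConnectedReductiveGroupData.glWeylGroup n))

end SymmLaurent

/-! ### The Satake isomorphism and Satake parameters for `GL_n` (proofs deferred) -/

section Theorems

variable (n : ℕ) (F : Type u) [Field F] [ValuativeRel F] [TopologicalSpace F]
  [IsNonarchimedeanLocalField F]

/-- **Satake isomorphism for `GL_n`** (Satake 1963; Tamagawa 1963; Cartier, Corvallis 1979,
Theorem 4.1 and §IV.2 Example; Gross, *On the Satake isomorphism*, §3): the spherical Hecke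
algebra `ℋ(GL_n(F), GL_n(𝒪_F))` over `ℂ` is isomorphic to `ℂ[e_1, …, e_n, e_n⁻¹]`, the
operator `T_i` corresponding to `q^{i(n-i)/2} e_i`. [cite: CartierCorvallis1979, Thm. 4.1] -/
def SatakeParametersGL.satake_gl : Prop :=
  Nonempty (heckeAlgebra ℂ (GL (Fin n) F) (glInt n F) ≃ₐ[ℂ] symmLaurent n)

/-- The Satake isomorphism statement of module `ReductiveGroupData` holds for the datum
`GL_n / F` and its hyperspecial subgroup `GL_n(𝒪_F)` (Cartier, Corvallis 1979, Theorem 4.1), given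
the named facts `satake_gl` (`hgl`) and `symmLaurent_equiv_weylInvariants` (`hsymm`).
[cite: CartierCorvallis1979, Thm. 4.1] -/
theorem SatakeParametersGL.satakeIsomorphismStatement_gl (hgl : SatakeParametersGL.satake_gl n F)
    (hsymm : symmLaurent_equiv_weylInvariants n) :
    SatakeIsomorphismStatement (ConnectedReductiveGroupData.gl n F) (glInt n F) := by
  intro _
  obtain ⟨e⟩ := hgl
  obtain ⟨e'⟩ := hsymm
  exact ⟨e.trans e'⟩

/-- `(GL_n(F), GL_n(𝒪_F))` is a **Gelfand pair**: the spherical Hecke algebra is commutative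
(by the Satake isomorphism, or by Gelfand's trick with the transpose; Cartier, Corvallis 1979,
§IV.1; Shimura, Theorem 3.20). [cite: CartierCorvallis1979, §IV.1] -/
def SatakeParametersGL.isGelfandPair_glInt : Prop :=
  IsGelfandPair ℂ (GL (Fin n) F) (glInt n F)

variable {n F}
variable {V : Type*} [AddCommGroup V] [Module ℂ V] (ρ : Representation ℂ (GL (Fin n) F) V)

/-- **Multiplicity one for spherical vectors**: an irreducible admissible representation of
`GL_n(F)` has at most a line of `GL_n(𝒪_F)`-fixed vectors, since `V^{K₀}` is an irreducible
finite-dimensional module over the commutative algebra `ℋ(G, K₀)` (Cartier, Corvallis 1979,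
§IV.1, Corollary 4.1 and §IV.4; Bump, *Automorphic forms and representations*, Theorem 4.6.2).
[cite: CartierCorvallis1979, Cor. 4.1] -/
def finrank_fixedPoints_glInt_le_one : Prop :=
  ∀ [ρ.IsIrreducible] (_hadm : ρ.IsAdmissible),
    Module.finrank ℂ (ρ.fixedPoints (glInt n F)) ≤ 1

/-- **Existence and uniqueness of Satake parameters**: an irreducible admissible unramified
representation of `GL_n(F)` has a unique multiset of Satake parameters with respect to any
uniformizer `ϖ` (Cartier, Corvallis 1979, §IV.4; Shimura, Theorem 3.21; Borel, Corvallis 1979,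
§7 and §10.4). [cite: CartierCorvallis1979, §IV.4] -/
def SatakeParametersGL.existsUnique_isSatakeParameter : Prop :=
  ∀ [ρ.IsIrreducible] (_hadm : ρ.IsAdmissible) (_hK : ρ.IsUnramified (glInt n F)) {ϖ : Fˣ}
    (_hϖ : (valuation F).IsUniformizer (ϖ : F)),
    ∃! α : Multiset ℂ, IsSatakeParameter ρ ϖ α

/-- The Satake parameters do not depend on the choice of uniformizer: the double cosets
`K₀ diag(ϖ,…,ϖ,1,…,1) K₀`, hence the operators `T_i`, only depend on `ϖ` up to units
(Cartan decomposition; Cartier, Corvallis 1979, §IV.1; Shimura, Theorem 3.21).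
[cite: CartierCorvallis1979, §IV.1] -/
def isSatakeParameter_indep : Prop :=
  ∀ {ϖ ϖ' : Fˣ} (_hϖ : (valuation F).IsUniformizer (ϖ : F))
    (_hϖ' : (valuation F).IsUniformizer (ϖ' : F)) (α : Multiset ℂ),
    IsSatakeParameter ρ ϖ α ↔ IsSatakeParameter ρ ϖ' α

/-- Satake parameters are **non-zero**: `T_n = ρ(ϖ · 1)` restricted to `V^{K₀}` is invertible, so
`q^{0} e_n(α) = ∏ α_j ≠ 0` (Cartier, Corvallis 1979, §IV.2; Shimura, Theorem 3.21).
[cite: CartierCorvallis1979, §IV.2] -/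
def IsSatakeParameter.forall_ne_zero : Prop :=
  ∀ {ρ : Representation ℂ (GL (Fin n) F) V} {ϖ : Fˣ} (_hϖ : (valuation F).IsUniformizer (ϖ : F))
    {α : Multiset ℂ} (_hα : IsSatakeParameter ρ ϖ α),
    ∀ a ∈ α, a ≠ 0

open MeasureTheory in
/-- **Tempered ⇔ unitary Satake parameters** (Macdonald, *Spherical functions on a group of
p-adic type*, 1971, Ch. IV–V; Cartier, Corvallis 1979, §IV.5; Borel, Corvallis 1979, §10.4):
an irreducible admissible unramified representation of `GL_n(F)` with Satake parameters `α`
(unitary normalisation of `IsSatakeParameter`) is tempered — matrix coefficients almost `L²`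
modulo the centre, `Representation.IsTempered` of module `MatrixCoefficients`, for a Haar
measure `μ` on `GL_n(F) / Z` — iff `|α_j| = 1` for all `j`. [cite: CartierCorvallis1979, §IV.5] -/
def isTempered_iff_forall_norm_eq_one : Prop :=
  ∀ [MeasurableSpace (GL (Fin n) F ⧸ Subgroup.center (GL (Fin n) F))]
    [BorelSpace (GL (Fin n) F ⧸ Subgroup.center (GL (Fin n) F))]
    (μ : Measure (GL (Fin n) F ⧸ Subgroup.center (GL (Fin n) F))) [μ.IsHaarMeasure]
    [ρ.IsIrreducible] (_hadm : ρ.IsAdmissible) {ϖ : Fˣ} (_hϖ : (valuation F).IsUniformizer (ϖ : F))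
    {α : Multiset ℂ} (_hα : IsSatakeParameter ρ ϖ α),
    ρ.IsTempered μ ↔ ∀ a ∈ α, ‖a‖ = 1

end Theorems

/-! ### Unramified L-parameters of `GL_n` with given Frobenius eigenvalues -/

namespace LParameter

variable {F : Type u} [Field F] [ValuativeRel F] [TopologicalSpace F] [IsNonarchimedeanLocalField F]
  {n : ℕ}

/-- The L-parameter `φ` of `GL_n` is **unramified with Frobenius eigenvalues `α`**: `φ` is
unramified (`LParameter.IsUnramified`: trivial on inertia, trivial `SL₂`) and for every
`w ∈ W_F` of degree `1` (an arithmetic Frobenius, sign convention of module `WeilGroup`) the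
matrix `φ(w) ∈ GL_n(ℂ)` is diagonalisable with multiset of eigenvalues `α`, i.e. conjugate to
`diag(d)` with `{d_j} = α`.  Under the unramified local Langlands correspondence for `GL_n` this
matches the representation with Satake parameters `α` (Borel, Corvallis 1979, §§7, 9.5, 10.4;
dot-notation extension of the H21 structure `LParameter`). [cite: BorelCorvallis1979, §10.4] -/
def IsUnramifiedWith (φ : LParameter (LGroupData.gl F n)) (α : Multiset ℂ) : Prop :=
  φ.IsUnramified ∧ ∀ w : GaloisRepresentations.WeilGroup F, GaloisRepresentations.WeilGroup.deg w = 1 →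
    ∃ (g : GL (Fin (LGroupData.gl F n).rank) ℂ) (d : Fin (LGroupData.gl F n).rank → ℂ),
      (((φ.φ w).left : GL (Fin (LGroupData.gl F n).rank) ℂ) :
          Matrix (Fin (LGroupData.gl F n).rank) (Fin (LGroupData.gl F n).rank) ℂ) =
        (g : Matrix _ _ ℂ) * Matrix.diagonal d * ((g⁻¹ : GL _ ℂ) : Matrix _ _ ℂ) ∧
      Multiset.map d Finset.univ.val = α

/-- An L-parameter unramified with eigenvalues `α` is unramified. [folklore] -/
theorem IsUnramifiedWith.isUnramified {φ : LParameter (LGroupData.gl F n)} {α : Multiset ℂ}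
    (h : φ.IsUnramifiedWith α) : φ.IsUnramified :=
  h.1

/-- The eigenvalue multiset of an unramified parameter of `GL_n` has `n` elements (given the
`LocalGaloisGroup` named facts `IsFrobPow.mul`, `IsFrobPow.unique`, `exists_isFrobPow`, which
provide a Weil group element of degree `1` via `WeilGroup.deg_surjective`). [folklore] -/
theorem IsUnramifiedWith.card_eq (hmul : GaloisRepresentations.IsFrobPow.mul (F := F))
    (huniq : GaloisRepresentations.IsFrobPow.unique (F := F)) (hex : GaloisRepresentations.exists_isFrobPow (F := F))
    {φ : LParameter (LGroupData.gl F n)} {α : Multiset ℂ}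
    (h : φ.IsUnramifiedWith α) : Multiset.card α = n := by
  obtain ⟨w, hw⟩ := GaloisRepresentations.WeilGroup.deg_surjective hmul huniq hex 1
  obtain ⟨-, d, -, hd⟩ := h.2 w hw
  rw [← hd, Multiset.card_map]
  exact Finset.card_fin n

end LParameter

end Literature.NumberTheory.Automorphic
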